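import Summits.Parity.GeneralizedHardyLittlewood.Theorems.PrimeLevelFamEdgeMomentsBeyondDiagonalDiagDecorShiftedP2P2Lpow
import Summits.Parity.GeneralizedHardyLittlewood.Theorems.PrimeLevelFamEdgeMomentsBeyondDiagonalDiagDecorOrderTwoTwoCombine
import HarnessLib

/-!
# Route `PrimeLevelFamEdge`, crux K_A `MomentsBeyondDiagonal` (stmt-Parity-20007), line «petersson_layers» v4, stub `stub_diag`:
# **(Poly₂₂) REDUCED TO THE `M₄`-FAMILY: the polynomial part of the order-`(2,2)` target from the sixteen landed engine
# instances plus bounds for the four `M₄`-decorated monomials**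

The polynomial weight of order `(2,2)` (`…DiagDecorOrderTwoTwoHecke.selbergOrderTwoTwo_split`, p828453) is the sum of twenty
monomials; sixteen are evaluated by `…DiagDecorShiftedLpow.abs_selbergLpow_sub_le` (`ττL^m`, `m ≤ 5`),
`…DiagDecorShiftedP2Lpow.abs_selbergP2Lpow_sub_le(')` (`τP₂·τ·L^m` and mirror, `m ≤ 3`) and
`…DiagDecorShiftedP2P2Lpow.abs_selbergP2P2Lpow_sub_le` (`τP₂·τP₂·L^m`, `m ≤ 1`); only the top-degree ones
(`ττL⁵/160`, `−τP₂τL³/48` twice, `(3/16)τP₂τP₂L`) reach the main order `log²M`. The four `M₄ = τ(3P₂²−2P₄)`-decorated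
monomials (`L¹/32` and `E₀₀L⁰/16` on either variable) are taken as hypotheses `|Sel(·)| ≤ C·log M` — their true size is
`O(log^{m−1}M)` but no landed engine covers them (see the census note in `…DiagDecorOrderTwoTwoAssembly`, p828571).

* (bookkeeping `orderTwoTwo_combine` in `…DiagDecorOrderTwoTwoCombine`);
* `abs_selbergOrderTwoTwoPoly_sub_le_of_M4` — **`|Sel(poly₂₂)(M) − (π²/6)²(Φ₅/160 − Ψ₃/24 + (3/16)Ξ₁)(λ,P)·log²M| ≤ C·log M`
  from the `M₄` bounds** (`0 ≤ λ ≤ 1`, `P₀ = P₁ = 0`, arbitrary `E_ab, μ₂, μ₄`), i.e. (Poly₂₂) of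
  `…DiagDecorOrderTwoTwoAssembly.orderTwoTwo_target_of_poly_of_remainder` with
  `𝔎(λ,P) = (π²/6)²(Φ₅(λ,P)/160 − Ψ₃(λ,P)/24 + (3/16)Ξ₁(λ,P))` (`Φ_m, Ψ_m, Ξ_m` the block functionals of the three engines);
* `orderTwoTwoPoly_of_M4` — the same packaged in the exact hypothesis shape (Poly₂₂).

Def-free; theorems only. Helper `--supports stmt-Parity-20007`; closes nothing; K_A, K_B and the Parity summit are NOT proved;
nothing about Landau–Siegel zeros.

## References
* E. Kowalski, P. Michel, J. VanderKam, J. reine angew. Math. 526 (2000), (23)–(28) pp. 13–15 and Prop. 5.1 p. 18.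
  [cite: KowalskiMichelVanderKam2000, (23)–(28) — derivation (order-(2,2) piece of the diagonal main term, general Q)]
-/

noncomputable section

open scoped Real ArithmeticFunction.Moebius
open Finset ArithmeticFunction Polynomial MeasureTheory intervalIntegral

namespace Summit.Parity.GeneralizedHardyLittlewood.Theorems.MomentsBeyondDiagonal.DiagKernel

open Literature.NumberTheory.LFunctions Literature.NumberTheory.LFunctions.KMV2000
open Literature.NumberTheory.Sieve (one_le_log_of_three_le)

/-! ### The polynomial part of order `(2,2)` -/

/-- **(Poly₂₂) FROM THE `M₄`-FAMILY BOUNDS**: for `0 ≤ λ ≤ 1`, `P₀ = P₁ = 0`, arbitrary reals `E_ab, μ₂, μ₄`, and bounds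
`|Sel(τ(3P₂²−2P₄)(k₁)·τ(k₂)·L^m)| ≤ C log M`, `|Sel(τ(k₁)·τ(3P₂²−2P₄)(k₂)·L^m)| ≤ C log M` (`m ≤ 1`, `M ≥ 3`), there is
`C` with `|Sel(poly₂₂)(M) − (π²/6)²(Φ₅/160 − Ψ₃/24 + (3/16)Ξ₁)·log²M| ≤ C·log M` for all `M ≥ 3`.
[cite: KowalskiMichelVanderKam2000, (23)–(28) and Prop. 5.1 — derivation (order-(2,2) piece of the diagonal main term)] -/
theorem abs_selbergOrderTwoTwoPoly_sub_le_of_M4 (P : ℝ[X]) (hP0 : P.coeff 0 = 0) (hP1 : P.coeff 1 = 0)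
    {lam : ℝ} (hlam0 : 0 ≤ lam) (hlam1 : lam ≤ 1) (E₀₀ E₀₁ E₁₀ E₀₂ E₂₀ E₁₁ E₁₂ E₂₁ E₂₂ μ₂ μ₄ : ℝ)
    (hM4a : ∀ m : ℕ, m ≤ 1 → ∃ C : ℝ, ∀ M : ℝ, 3 ≤ M →
      |∑ c ∈ Icc 1 ⌊M⌋₊, ∑ g ∈ Icc 1 (⌊M⌋₊ / c), (μ g : ℝ) * c *
        ∑ k₁ ∈ Icc 1 (⌊M⌋₊ / (c * g)), ∑ k₂ ∈ Icc 1 (⌊M⌋₊ / (c * g)),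
          ((μ (c * g * k₁) : ℝ) * ((psi (c * g * k₁))⁻¹ *
              P.eval (Real.log (M / ((c * g * k₁ : ℕ) : ℝ)) / Real.log M)) / ((c * g * k₁ : ℕ) : ℝ)) *
            ((μ (c * g * k₂) : ℝ) * ((psi (c * g * k₂))⁻¹ *
              P.eval (Real.log (M / ((c * g * k₂ : ℕ) : ℝ)) / Real.log M)) / ((c * g * k₂ : ℕ) : ℝ)) *
            ((k₁.divisors.card : ℝ) * (3 * (∑ p ∈ k₁.primeFactors, Real.log p ^ 2) ^ 2 - 2 * ∑ p ∈ k₁.primeFactors, Real.log p ^ 4) *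
                (k₂.divisors.card : ℝ) * (2 * (lam * Real.log M) - 2 * Real.log g - Real.log k₁ - Real.log k₂) ^ m)| ≤ C * Real.log M)
    (hM4b : ∀ m : ℕ, m ≤ 1 → ∃ C : ℝ, ∀ M : ℝ, 3 ≤ M →
      |∑ c ∈ Icc 1 ⌊M⌋₊, ∑ g ∈ Icc 1 (⌊M⌋₊ / c), (μ g : ℝ) * c *
        ∑ k₁ ∈ Icc 1 (⌊M⌋₊ / (c * g)), ∑ k₂ ∈ Icc 1 (⌊M⌋₊ / (c * g)),
          ((μ (c * g * k₁) : ℝ) * ((psi (c * g * k₁))⁻¹ *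
              P.eval (Real.log (M / ((c * g * k₁ : ℕ) : ℝ)) / Real.log M)) / ((c * g * k₁ : ℕ) : ℝ)) *
            ((μ (c * g * k₂) : ℝ) * ((psi (c * g * k₂))⁻¹ *
              P.eval (Real.log (M / ((c * g * k₂ : ℕ) : ℝ)) / Real.log M)) / ((c * g * k₂ : ℕ) : ℝ)) *
            ((k₁.divisors.card : ℝ) * ((k₂.divisors.card : ℝ) *
                (3 * (∑ p ∈ k₂.primeFactors, Real.log p ^ 2) ^ 2 - 2 * ∑ p ∈ k₂.primeFactors, Real.log p ^ 4)) *
                (2 * (lam * Real.log M) - 2 * Real.log g - Real.log k₁ - Real.log k₂) ^ m)| ≤ C * Real.log M) :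
    ∃ C : ℝ, ∀ M : ℝ, 3 ≤ M →
      |∑ c ∈ Icc 1 ⌊M⌋₊, ∑ g ∈ Icc 1 (⌊M⌋₊ / c), (μ g : ℝ) * c *
        ∑ k₁ ∈ Icc 1 (⌊M⌋₊ / (c * g)), ∑ k₂ ∈ Icc 1 (⌊M⌋₊ / (c * g)),
          ((μ (c * g * k₁) : ℝ) * ((psi (c * g * k₁))⁻¹ *
              P.eval (Real.log (M / ((c * g * k₁ : ℕ) : ℝ)) / Real.log M)) / ((c * g * k₁ : ℕ) : ℝ)) *
            ((μ (c * g * k₂) : ℝ) * ((psi (c * g * k₂))⁻¹ *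
              P.eval (Real.log (M / ((c * g * k₂ : ℕ) : ℝ)) / Real.log M)) / ((c * g * k₂ : ℕ) : ℝ)) *
            (1 / 160 * ((k₁.divisors.card : ℝ) * (k₂.divisors.card : ℝ) *
                (2 * (lam * Real.log M) - 2 * Real.log g - Real.log k₁ - Real.log k₂) ^ 5) +
              E₀₀ / 16 * ((k₁.divisors.card : ℝ) * (k₂.divisors.card : ℝ) *
                (2 * (lam * Real.log M) - 2 * Real.log g - Real.log k₁ - Real.log k₂) ^ 4) +
              ((E₀₁ + E₁₀) / 4 - μ₂ / 3) * ((k₁.divisors.card : ℝ) * (k₂.divisors.card : ℝ) *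
                (2 * (lam * Real.log M) - 2 * Real.log g - Real.log k₁ - Real.log k₂) ^ 3) +
              ((E₀₂ + E₂₀) / 4 + E₁₁) * ((k₁.divisors.card : ℝ) * (k₂.divisors.card : ℝ) *
                (2 * (lam * Real.log M) - 2 * Real.log g - Real.log k₁ - Real.log k₂) ^ 2) +
              (2 * μ₄ + E₁₂ + E₂₁) * ((k₁.divisors.card : ℝ) * (k₂.divisors.card : ℝ) *
                (2 * (lam * Real.log M) - 2 * Real.log g - Real.log k₁ - Real.log k₂) ^ 1) +
              E₂₂ * ((k₁.divisors.card : ℝ) * (k₂.divisors.card : ℝ) *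
                (2 * (lam * Real.log M) - 2 * Real.log g - Real.log k₁ - Real.log k₂) ^ 0) +
              (-1 / 48) * ((k₁.divisors.card : ℝ) * (∑ p ∈ k₁.primeFactors, Real.log p ^ 2) * (k₂.divisors.card : ℝ) *
                (2 * (lam * Real.log M) - 2 * Real.log g - Real.log k₁ - Real.log k₂) ^ 3) +
              (-1 / 48) * ((k₁.divisors.card : ℝ) * ((k₂.divisors.card : ℝ) * ∑ p ∈ k₂.primeFactors, Real.log p ^ 2) *
                (2 * (lam * Real.log M) - 2 * Real.log g - Real.log k₁ - Real.log k₂) ^ 3) +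
              (-E₀₀ / 8) * ((k₁.divisors.card : ℝ) * (∑ p ∈ k₁.primeFactors, Real.log p ^ 2) * (k₂.divisors.card : ℝ) *
                (2 * (lam * Real.log M) - 2 * Real.log g - Real.log k₁ - Real.log k₂) ^ 2) +
              (-E₀₀ / 8) * ((k₁.divisors.card : ℝ) * ((k₂.divisors.card : ℝ) * ∑ p ∈ k₂.primeFactors, Real.log p ^ 2) *
                (2 * (lam * Real.log M) - 2 * Real.log g - Real.log k₁ - Real.log k₂) ^ 2) +
              (3 * μ₂ - (E₀₁ + E₁₀) / 4) * ((k₁.divisors.card : ℝ) * (∑ p ∈ k₁.primeFactors, Real.log p ^ 2) * (k₂.divisors.card : ℝ) *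
                (2 * (lam * Real.log M) - 2 * Real.log g - Real.log k₁ - Real.log k₂) ^ 1) +
              (3 * μ₂ - (E₀₁ + E₁₀) / 4) * ((k₁.divisors.card : ℝ) * ((k₂.divisors.card : ℝ) * ∑ p ∈ k₂.primeFactors, Real.log p ^ 2) *
                (2 * (lam * Real.log M) - 2 * Real.log g - Real.log k₁ - Real.log k₂) ^ 1) +
              ((E₀₂ + E₂₀) / 4 - E₁₁) * ((k₁.divisors.card : ℝ) * (∑ p ∈ k₁.primeFactors, Real.log p ^ 2) * (k₂.divisors.card : ℝ) *
                (2 * (lam * Real.log M) - 2 * Real.log g - Real.log k₁ - Real.log k₂) ^ 0) +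
              ((E₀₂ + E₂₀) / 4 - E₁₁) * ((k₁.divisors.card : ℝ) * ((k₂.divisors.card : ℝ) * ∑ p ∈ k₂.primeFactors, Real.log p ^ 2) *
                (2 * (lam * Real.log M) - 2 * Real.log g - Real.log k₁ - Real.log k₂) ^ 0) +
              3 / 16 * ((k₁.divisors.card : ℝ) * (∑ p ∈ k₁.primeFactors, Real.log p ^ 2) *
                ((k₂.divisors.card : ℝ) * (∑ p ∈ k₂.primeFactors, Real.log p ^ 2)) *
                (2 * (lam * Real.log M) - 2 * Real.log g - Real.log k₁ - Real.log k₂) ^ 1) +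
              3 * E₀₀ / 8 * ((k₁.divisors.card : ℝ) * (∑ p ∈ k₁.primeFactors, Real.log p ^ 2) *
                ((k₂.divisors.card : ℝ) * (∑ p ∈ k₂.primeFactors, Real.log p ^ 2)) *
                (2 * (lam * Real.log M) - 2 * Real.log g - Real.log k₁ - Real.log k₂) ^ 0) +
              1 / 32 * ((k₁.divisors.card : ℝ) * (3 * (∑ p ∈ k₁.primeFactors, Real.log p ^ 2) ^ 2 - 2 * ∑ p ∈ k₁.primeFactors, Real.log p ^ 4) *
                (k₂.divisors.card : ℝ) * (2 * (lam * Real.log M) - 2 * Real.log g - Real.log k₁ - Real.log k₂) ^ 1) +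
              1 / 32 * ((k₁.divisors.card : ℝ) * ((k₂.divisors.card : ℝ) *
                (3 * (∑ p ∈ k₂.primeFactors, Real.log p ^ 2) ^ 2 - 2 * ∑ p ∈ k₂.primeFactors, Real.log p ^ 4)) *
                (2 * (lam * Real.log M) - 2 * Real.log g - Real.log k₁ - Real.log k₂) ^ 1) +
              E₀₀ / 16 * ((k₁.divisors.card : ℝ) * (3 * (∑ p ∈ k₁.primeFactors, Real.log p ^ 2) ^ 2 - 2 * ∑ p ∈ k₁.primeFactors, Real.log p ^ 4) *
                (k₂.divisors.card : ℝ) * (2 * (lam * Real.log M) - 2 * Real.log g - Real.log k₁ - Real.log k₂) ^ 0) +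
              E₀₀ / 16 * ((k₁.divisors.card : ℝ) * ((k₂.divisors.card : ℝ) *
                (3 * (∑ p ∈ k₂.primeFactors, Real.log p ^ 2) ^ 2 - 2 * ∑ p ∈ k₂.primeFactors, Real.log p ^ 4)) *
                (2 * (lam * Real.log M) - 2 * Real.log g - Real.log k₁ - Real.log k₂) ^ 0)) -
        (π ^ 2 / 6) ^ 2 * ((∑ j ∈ Finset.range (5 + 1), ∑ i ∈ Finset.range (j + 1),
            ((5 : ℕ).choose j : ℝ) * (j.choose i : ℝ) * 2 ^ (5 - j) *
              ∫ u in (0 : ℝ)..1, (((Polynomial.C lam - X) ^ (5 - j) * derivative (derivative (X ^ i * P))) *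
                derivative (derivative (X ^ (j - i) * P))).eval u) / 160 -
          (∑ j ∈ Finset.range (3 + 1), ∑ i ∈ Finset.range (j + 1),
            ((3 : ℕ).choose j : ℝ) * (j.choose i : ℝ) * 2 ^ (3 - j) *
              ∫ u in (0 : ℝ)..1, (((Polynomial.C lam - X) ^ (3 - j) * (-(2 : ℝ) • (X ^ i * P))) *
                derivative (derivative (X ^ (j - i) * P))).eval u) / 24 +
          3 / 16 * (∑ j ∈ Finset.range (1 + 1), ∑ i ∈ Finset.range (j + 1),
            ((1 : ℕ).choose j : ℝ) * (j.choose i : ℝ) * 2 ^ (1 - j) *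
              ∫ u in (0 : ℝ)..1, (((Polynomial.C lam - X) ^ (1 - j) * (-(2 : ℝ) • (X ^ i * P))) *
                (-(2 : ℝ) • (X ^ (j - i) * P))).eval u)) * Real.log M ^ 2| ≤ C * Real.log M := by
  obtain ⟨C5, hC5, h5⟩ := abs_selbergLpow_sub_le P hP0 hP1 5 hlam0 hlam1
  obtain ⟨C4, hC4, h4⟩ := abs_selbergLpow_sub_le P hP0 hP1 4 hlam0 hlam1
  obtain ⟨C3, hC3, h3⟩ := abs_selbergLpow_sub_le P hP0 hP1 3 hlam0 hlam1
  obtain ⟨C2, hC2, h2⟩ := abs_selbergLpow_sub_le P hP0 hP1 2 hlam0 hlam1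
  obtain ⟨C1, hC1, h1⟩ := abs_selbergLpow_sub_le P hP0 hP1 1 hlam0 hlam1
  obtain ⟨C0, hC0, h0⟩ := abs_selbergLpow_sub_le P hP0 hP1 0 hlam0 hlam1
  obtain ⟨D3, hD3, g3⟩ := abs_selbergP2Lpow_sub_le P hP0 hP1 3 hlam0 hlam1
  obtain ⟨D3', hD3', g3'⟩ := abs_selbergP2Lpow_sub_le' P hP0 hP1 3 hlam0 hlam1
  obtain ⟨D2, hD2, g2⟩ := abs_selbergP2Lpow_sub_le P hP0 hP1 2 hlam0 hlam1
  obtain ⟨D2', hD2', g2'⟩ := abs_selbergP2Lpow_sub_le' P hP0 hP1 2 hlam0 hlam1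
  obtain ⟨D1, hD1, g1⟩ := abs_selbergP2Lpow_sub_le P hP0 hP1 1 hlam0 hlam1
  obtain ⟨D1', hD1', g1'⟩ := abs_selbergP2Lpow_sub_le' P hP0 hP1 1 hlam0 hlam1
  obtain ⟨D0, hD0, g0⟩ := abs_selbergP2Lpow_sub_le P hP0 hP1 0 hlam0 hlam1
  obtain ⟨D0', hD0', g0'⟩ := abs_selbergP2Lpow_sub_le' P hP0 hP1 0 hlam0 hlam1
  obtain ⟨U1, hU1, u1⟩ := abs_selbergP2P2Lpow_sub_le P hP0 hP1 1 hlam0 hlam1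
  obtain ⟨U0, hU0, u0⟩ := abs_selbergP2P2Lpow_sub_le P hP0 hP1 0 hlam0 hlam1
  obtain ⟨A1, a1⟩ := hM4a 1 le_rfl
  obtain ⟨A0, a0⟩ := hM4a 0 (Nat.zero_le 1)
  obtain ⟨B1, b1⟩ := hM4b 1 le_rfl
  obtain ⟨B0, b0⟩ := hM4b 0 (Nat.zero_le 1)
  have hK : 0 ≤ (π ^ 2 / 6 : ℝ) ^ 2 := by positivity
  refine ⟨?_, fun M hM ↦ ?_⟩
  swap
  · have hℓ1 : 1 ≤ Real.log M := one_le_log_of_three_le hM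
    simp only [selbergProd_add, selbergProd_const_mul]
    exact orderTwoTwo_combine (E₀₀ := E₀₀) (E₀₁ := E₀₁) (E₁₀ := E₁₀) (E₀₂ := E₀₂) (E₂₀ := E₂₀) (E₁₁ := E₁₁)
      (E₁₂ := E₁₂) (E₂₁ := E₂₁) (E₂₂ := E₂₂) (μ₂ := μ₂) (μ₄ := μ₄) hℓ1 hK
      hC4.le hC3.le hC2.le hC1.le hC0.le hD2.le hD2'.le hD1.le hD1'.le hD0.le hD0'.le hU0.le
      (h5 M hM) (h4 M hM) (h3 M hM) (h2 M hM) (h1 M hM) (h0 M hM)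
      (g3 M hM) (g3' M hM) (g2 M hM) (g2' M hM) (g1 M hM) (g1' M hM) (g0 M hM) (g0' M hM)
      (u1 M hM) (u0 M hM) (a1 M hM) (b1 M hM) (a0 M hM) (b0 M hM)

/-- **(Poly₂₂) in the exact hypothesis shape of `…DiagDecorOrderTwoTwoAssembly.orderTwoTwo_target_of_poly_of_remainder`**
(`𝔎(λ,P) = (π²/6)²(Φ₅/160 − Ψ₃/24 + (3/16)Ξ₁)`), from the `M₄`-family bounds for every `P`, `λ`.
[cite: KowalskiMichelVanderKam2000, (23)–(28) and Prop. 5.1 — derivation] -/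
theorem orderTwoTwoPoly_of_M4
    (hM4 : ∀ P : ℝ[X], P.coeff 0 = 0 → P.coeff 1 = 0 → ∀ lam : ℝ, 0 ≤ lam → lam ≤ 1 → ∀ m : ℕ, m ≤ 1 →
      (∃ C : ℝ, ∀ M : ℝ, 3 ≤ M →
      |∑ c ∈ Icc 1 ⌊M⌋₊, ∑ g ∈ Icc 1 (⌊M⌋₊ / c), (μ g : ℝ) * c *
        ∑ k₁ ∈ Icc 1 (⌊M⌋₊ / (c * g)), ∑ k₂ ∈ Icc 1 (⌊M⌋₊ / (c * g)),
          ((μ (c * g * k₁) : ℝ) * ((psi (c * g * k₁))⁻¹ *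
              P.eval (Real.log (M / ((c * g * k₁ : ℕ) : ℝ)) / Real.log M)) / ((c * g * k₁ : ℕ) : ℝ)) *
            ((μ (c * g * k₂) : ℝ) * ((psi (c * g * k₂))⁻¹ *
              P.eval (Real.log (M / ((c * g * k₂ : ℕ) : ℝ)) / Real.log M)) / ((c * g * k₂ : ℕ) : ℝ)) *
            ((k₁.divisors.card : ℝ) * (3 * (∑ p ∈ k₁.primeFactors, Real.log p ^ 2) ^ 2 - 2 * ∑ p ∈ k₁.primeFactors, Real.log p ^ 4) *
                (k₂.divisors.card : ℝ) * (2 * (lam * Real.log M) - 2 * Real.log g - Real.log k₁ - Real.log k₂) ^ m)| ≤ C * Real.log M) ∧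
      (∃ C : ℝ, ∀ M : ℝ, 3 ≤ M →
      |∑ c ∈ Icc 1 ⌊M⌋₊, ∑ g ∈ Icc 1 (⌊M⌋₊ / c), (μ g : ℝ) * c *
        ∑ k₁ ∈ Icc 1 (⌊M⌋₊ / (c * g)), ∑ k₂ ∈ Icc 1 (⌊M⌋₊ / (c * g)),
          ((μ (c * g * k₁) : ℝ) * ((psi (c * g * k₁))⁻¹ *
              P.eval (Real.log (M / ((c * g * k₁ : ℕ) : ℝ)) / Real.log M)) / ((c * g * k₁ : ℕ) : ℝ)) *
            ((μ (c * g * k₂) : ℝ) * ((psi (c * g * k₂))⁻¹ *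
              P.eval (Real.log (M / ((c * g * k₂ : ℕ) : ℝ)) / Real.log M)) / ((c * g * k₂ : ℕ) : ℝ)) *
            ((k₁.divisors.card : ℝ) * ((k₂.divisors.card : ℝ) *
                (3 * (∑ p ∈ k₂.primeFactors, Real.log p ^ 2) ^ 2 - 2 * ∑ p ∈ k₂.primeFactors, Real.log p ^ 4)) *
                (2 * (lam * Real.log M) - 2 * Real.log g - Real.log k₁ - Real.log k₂) ^ m)| ≤ C * Real.log M)) :
    ∀ P : ℝ[X], P.coeff 0 = 0 → P.coeff 1 = 0 → ∀ lam : ℝ, 0 ≤ lam → lam ≤ 1 →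
      ∀ E₀₀ E₀₁ E₁₀ E₀₂ E₂₀ E₁₁ E₁₂ E₂₁ E₂₂ μ₂ μ₄ : ℝ, ∃ C : ℝ, ∀ M : ℝ, 3 ≤ M →
      |∑ c ∈ Icc 1 ⌊M⌋₊, ∑ g ∈ Icc 1 (⌊M⌋₊ / c), (μ g : ℝ) * c *
        ∑ k₁ ∈ Icc 1 (⌊M⌋₊ / (c * g)), ∑ k₂ ∈ Icc 1 (⌊M⌋₊ / (c * g)),
          ((μ (c * g * k₁) : ℝ) * ((psi (c * g * k₁))⁻¹ *
              P.eval (Real.log (M / ((c * g * k₁ : ℕ) : ℝ)) / Real.log M)) / ((c * g * k₁ : ℕ) : ℝ)) *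
            ((μ (c * g * k₂) : ℝ) * ((psi (c * g * k₂))⁻¹ *
              P.eval (Real.log (M / ((c * g * k₂ : ℕ) : ℝ)) / Real.log M)) / ((c * g * k₂ : ℕ) : ℝ)) *
            (1 / 160 * ((k₁.divisors.card : ℝ) * (k₂.divisors.card : ℝ) *
                (2 * (lam * Real.log M) - 2 * Real.log g - Real.log k₁ - Real.log k₂) ^ 5) +
              E₀₀ / 16 * ((k₁.divisors.card : ℝ) * (k₂.divisors.card : ℝ) *
                (2 * (lam * Real.log M) - 2 * Real.log g - Real.log k₁ - Real.log k₂) ^ 4) +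
              ((E₀₁ + E₁₀) / 4 - μ₂ / 3) * ((k₁.divisors.card : ℝ) * (k₂.divisors.card : ℝ) *
                (2 * (lam * Real.log M) - 2 * Real.log g - Real.log k₁ - Real.log k₂) ^ 3) +
              ((E₀₂ + E₂₀) / 4 + E₁₁) * ((k₁.divisors.card : ℝ) * (k₂.divisors.card : ℝ) *
                (2 * (lam * Real.log M) - 2 * Real.log g - Real.log k₁ - Real.log k₂) ^ 2) +
              (2 * μ₄ + E₁₂ + E₂₁) * ((k₁.divisors.card : ℝ) * (k₂.divisors.card : ℝ) *
                (2 * (lam * Real.log M) - 2 * Real.log g - Real.log k₁ - Real.log k₂) ^ 1) +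
              E₂₂ * ((k₁.divisors.card : ℝ) * (k₂.divisors.card : ℝ) *
                (2 * (lam * Real.log M) - 2 * Real.log g - Real.log k₁ - Real.log k₂) ^ 0) +
              (-1 / 48) * ((k₁.divisors.card : ℝ) * (∑ p ∈ k₁.primeFactors, Real.log p ^ 2) * (k₂.divisors.card : ℝ) *
                (2 * (lam * Real.log M) - 2 * Real.log g - Real.log k₁ - Real.log k₂) ^ 3) +
              (-1 / 48) * ((k₁.divisors.card : ℝ) * ((k₂.divisors.card : ℝ) * ∑ p ∈ k₂.primeFactors, Real.log p ^ 2) *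
                (2 * (lam * Real.log M) - 2 * Real.log g - Real.log k₁ - Real.log k₂) ^ 3) +
              (-E₀₀ / 8) * ((k₁.divisors.card : ℝ) * (∑ p ∈ k₁.primeFactors, Real.log p ^ 2) * (k₂.divisors.card : ℝ) *
                (2 * (lam * Real.log M) - 2 * Real.log g - Real.log k₁ - Real.log k₂) ^ 2) +
              (-E₀₀ / 8) * ((k₁.divisors.card : ℝ) * ((k₂.divisors.card : ℝ) * ∑ p ∈ k₂.primeFactors, Real.log p ^ 2) *
                (2 * (lam * Real.log M) - 2 * Real.log g - Real.log k₁ - Real.log k₂) ^ 2) +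
              (3 * μ₂ - (E₀₁ + E₁₀) / 4) * ((k₁.divisors.card : ℝ) * (∑ p ∈ k₁.primeFactors, Real.log p ^ 2) * (k₂.divisors.card : ℝ) *
                (2 * (lam * Real.log M) - 2 * Real.log g - Real.log k₁ - Real.log k₂) ^ 1) +
              (3 * μ₂ - (E₀₁ + E₁₀) / 4) * ((k₁.divisors.card : ℝ) * ((k₂.divisors.card : ℝ) * ∑ p ∈ k₂.primeFactors, Real.log p ^ 2) *
                (2 * (lam * Real.log M) - 2 * Real.log g - Real.log k₁ - Real.log k₂) ^ 1) +
              ((E₀₂ + E₂₀) / 4 - E₁₁) * ((k₁.divisors.card : ℝ) * (∑ p ∈ k₁.primeFactors, Real.log p ^ 2) * (k₂.divisors.card : ℝ) *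
                (2 * (lam * Real.log M) - 2 * Real.log g - Real.log k₁ - Real.log k₂) ^ 0) +
              ((E₀₂ + E₂₀) / 4 - E₁₁) * ((k₁.divisors.card : ℝ) * ((k₂.divisors.card : ℝ) * ∑ p ∈ k₂.primeFactors, Real.log p ^ 2) *
                (2 * (lam * Real.log M) - 2 * Real.log g - Real.log k₁ - Real.log k₂) ^ 0) +
              3 / 16 * ((k₁.divisors.card : ℝ) * (∑ p ∈ k₁.primeFactors, Real.log p ^ 2) *
                ((k₂.divisors.card : ℝ) * (∑ p ∈ k₂.primeFactors, Real.log p ^ 2)) *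
                (2 * (lam * Real.log M) - 2 * Real.log g - Real.log k₁ - Real.log k₂) ^ 1) +
              3 * E₀₀ / 8 * ((k₁.divisors.card : ℝ) * (∑ p ∈ k₁.primeFactors, Real.log p ^ 2) *
                ((k₂.divisors.card : ℝ) * (∑ p ∈ k₂.primeFactors, Real.log p ^ 2)) *
                (2 * (lam * Real.log M) - 2 * Real.log g - Real.log k₁ - Real.log k₂) ^ 0) +
              1 / 32 * ((k₁.divisors.card : ℝ) * (3 * (∑ p ∈ k₁.primeFactors, Real.log p ^ 2) ^ 2 - 2 * ∑ p ∈ k₁.primeFactors, Real.log p ^ 4) *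
                (k₂.divisors.card : ℝ) * (2 * (lam * Real.log M) - 2 * Real.log g - Real.log k₁ - Real.log k₂) ^ 1) +
              1 / 32 * ((k₁.divisors.card : ℝ) * ((k₂.divisors.card : ℝ) *
                (3 * (∑ p ∈ k₂.primeFactors, Real.log p ^ 2) ^ 2 - 2 * ∑ p ∈ k₂.primeFactors, Real.log p ^ 4)) *
                (2 * (lam * Real.log M) - 2 * Real.log g - Real.log k₁ - Real.log k₂) ^ 1) +
              E₀₀ / 16 * ((k₁.divisors.card : ℝ) * (3 * (∑ p ∈ k₁.primeFactors, Real.log p ^ 2) ^ 2 - 2 * ∑ p ∈ k₁.primeFactors, Real.log p ^ 4) *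
                (k₂.divisors.card : ℝ) * (2 * (lam * Real.log M) - 2 * Real.log g - Real.log k₁ - Real.log k₂) ^ 0) +
              E₀₀ / 16 * ((k₁.divisors.card : ℝ) * ((k₂.divisors.card : ℝ) *
                (3 * (∑ p ∈ k₂.primeFactors, Real.log p ^ 2) ^ 2 - 2 * ∑ p ∈ k₂.primeFactors, Real.log p ^ 4)) *
                (2 * (lam * Real.log M) - 2 * Real.log g - Real.log k₁ - Real.log k₂) ^ 0)) -
        (fun (lam : ℝ) (P : ℝ[X]) ↦ (π ^ 2 / 6) ^ 2 * ((∑ j ∈ Finset.range (5 + 1), ∑ i ∈ Finset.range (j + 1),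
            ((5 : ℕ).choose j : ℝ) * (j.choose i : ℝ) * 2 ^ (5 - j) *
              ∫ u in (0 : ℝ)..1, (((Polynomial.C lam - X) ^ (5 - j) * derivative (derivative (X ^ i * P))) *
                derivative (derivative (X ^ (j - i) * P))).eval u) / 160 -
          (∑ j ∈ Finset.range (3 + 1), ∑ i ∈ Finset.range (j + 1),
            ((3 : ℕ).choose j : ℝ) * (j.choose i : ℝ) * 2 ^ (3 - j) *
              ∫ u in (0 : ℝ)..1, (((Polynomial.C lam - X) ^ (3 - j) * (-(2 : ℝ) • (X ^ i * P))) *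
                derivative (derivative (X ^ (j - i) * P))).eval u) / 24 +
          3 / 16 * (∑ j ∈ Finset.range (1 + 1), ∑ i ∈ Finset.range (j + 1),
            ((1 : ℕ).choose j : ℝ) * (j.choose i : ℝ) * 2 ^ (1 - j) *
              ∫ u in (0 : ℝ)..1, (((Polynomial.C lam - X) ^ (1 - j) * (-(2 : ℝ) • (X ^ i * P))) *
                (-(2 : ℝ) • (X ^ (j - i) * P))).eval u))) lam P * Real.log M ^ 2| ≤ C * Real.log M := by
  intro P hP0 hP1 lam hlam0 hlam1 E₀₀ E₀₁ E₁₀ E₀₂ E₂₀ E₁₁ E₁₂ E₂₁ E₂₂ μ₂ μ₄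
  exact abs_selbergOrderTwoTwoPoly_sub_le_of_M4 P hP0 hP1 hlam0 hlam1 E₀₀ E₀₁ E₁₀ E₀₂ E₂₀ E₁₁ E₁₂ E₂₁ E₂₂ μ₂ μ₄
    (fun m hm ↦ (hM4 P hP0 hP1 lam hlam0 hlam1 m hm).1) (fun m hm ↦ (hM4 P hP0 hP1 lam hlam0 hlam1 m hm).2)

end Summit.Parity.GeneralizedHardyLittlewood.Theorems.MomentsBeyondDiagonal.DiagKernel

end
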